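import Summits.QuantumFields.BalabanUV.T4Continuum.Support.DirichletDirectionalBesovCutoff

/-!
# `BalabanUV.T4Continuum.Support.DirichletCaccioppoli` — NE2 (node U1a) formalisation swarm, sub-row `T4-U1a.S-NE2-D1-DIRICHLET°`:
# THE DISCRETE CACCIOPPOLI INEQUALITY for a lattice field against a real cutoff — the first brick (H-A) of the typed plan «Δ1-HOLEFILL»
# for the located residue of «Δ1-LOCAL» (`t4/T4-EST-NE2-D1-LOCAL.md` §5) (unit b2b-balaban-t4-ne2-formalise-leaf-08, gen 5, file 8)

HONEST FRAMING.  Rung (B)+1 bookkeeping at MODEL level, finite torus; [folklore] finite lattice calculus; NE2 (U1a) is NOT proved by this file;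
spine PROVED 0/9 unchanged; NOT infinite volume, NOT the mass gap, NOT Clay.  HONEST DEPENDENCY (verbatim): «continuum YM on T⁴ ⇐ BetaPertH ∧
nine spine estimates (0/9 proved); BetaPertH ⇐ (D1) ∧ (D4) ∧ CAP+tail; G-an2-4 gates asym, D1 and NE2/3/4.»

WHAT THIS FILE PROVES (0 sorry).  For the torus difference `∂_ν = c(S_ν − 1)` and Laplacian `Δ = Σ_ν ∂_νᴴ∂_ν` of the tree (`B5Action121`), ANY
field `z : Tor N → ℂ` and ANY real cutoff `η` with `0 ≤ η`:
 * §1 the pointwise inequality behind Caccioppoli: with `s = η(x+e_ν)`, `t = η(x)`,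
   `½·s²‖∂_νz(x)‖² − ‖c‖²(s − t)²·(7∕2·‖z x‖² + ½·‖z(x+e_ν)‖²) ≤ Re( conj(∂_ν(η²z)(x)) · ∂_νz(x) )`
   (`∂_ν(η²z) = s²∂_νz + c(s² − t²)z`, `s + t ≤ 2s + |s − t|`, Young);
 * §2 **`caccioppoli`**: `½·Σ_ν Σ_x η(x+e_ν)²‖∂_νz(x)‖² ≤ Re⟨η²z, Δz⟩ + ‖c‖²·Σ_ν Σ_x (η(x+e_ν) − η(x))²·(7∕2‖z x‖² + ½‖z(x+e_ν)‖²)` —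
   the energy of `z` where `η = 1` is paid by the pairing of `η²z` with `Δz` (for a region solution: with the DATUM on the region, since
   `η²z` vanishes off the support of `z`) plus the mass of `z` on the transition set of `η` weighted by `‖c‖²|δη|²` (`~ ρ⁻²` for a cutoff of
   scale `ρ`): the input of Widman's hole-filling ∕ Morrey-decay iteration at a vertex;
 * `caccioppoli_region`: the same with `Re⟨η²z, 1_ΩΔz⟩` for `z` supported in `Ω`.

ABSOLUTE RULE (cell, verbatim): «No internally-minted statement may enter as a cited fact. Every hypothesis is either kernel-proved in
this package or a verbatim quotation of a PUBLISHED theorem with page reference. The manuscript(s) under audit are NOT citable for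
their own disputed steps — they are the thing under adjudication; programme-internal (2001/route/tribunal) claims are never citable.»
[folklore]; no definitions; no `def … : Prop` fact.  NOT CLAIMED: the Poincaré ∕ hole-filling steps (H-B)(H-C), anything at the residue; NE2; NE3.
-/

noncomputable section

open scoped BigOperators ComplexConjugate Matrix
open Finset

namespace Summit.QuantumFields.BalabanUV.T4Continuum.DirichletCaccioppoli

open Literature.MathematicalPhysics.QuantumFieldTheory.Balaban1983to89.B5Prop11Plancherel (Tor unitVec)
open Literature.MathematicalPhysics.QuantumFieldTheory.Balaban1983to89.B5Action121 (sdiff LapS sdiff_mulVec)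
open Summit.QuantumFields.BalabanUV.T4Continuum.DirichletDirectionalBesov (star_dotProduct_LapS star_dotProduct_eq_sum restrictTo)
open Summit.QuantumFields.BalabanUV.T4Continuum.DirichletDirectionalBesovCutoff (cut)

variable {d : ℕ} (N : Fin d → ℕ) [hN : ∀ μ, NeZero (N μ)]

/-! ## §1 The pointwise inequality -/

omit hN in
/-- the real core: for `s, t ≥ 0`, `X, P ≥ 0`, any `Q`, with `X ≤ k(P + Q)` (`k = ‖c‖ ≥ 0`),
`s²X² − k|s² − t²|·P·X ≥ ½s²X² − k²(s − t)²(7∕2·P² + ½·Q²)`. [folklore] -/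
theorem core_ineq {s t X P Q k : ℝ} (hs : 0 ≤ s) (ht : 0 ≤ t) (hX : 0 ≤ X) (hP : 0 ≤ P) (hk : 0 ≤ k)
    (hXk : X ≤ k * (P + Q)) :
    1 / 2 * s ^ 2 * X ^ 2 - k ^ 2 * (s - t) ^ 2 * (7 / 2 * P ^ 2 + 1 / 2 * Q ^ 2) ≤ s ^ 2 * X ^ 2 - k * |s ^ 2 - t ^ 2| * P * X := by
  have hfac : |s ^ 2 - t ^ 2| = |s - t| * (s + t) := by
    rw [show s ^ 2 - t ^ 2 = (s - t) * (s + t) by ring, abs_mul, abs_of_nonneg (show (0 : ℝ) ≤ s + t by linarith)]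
  rw [hfac]
  have hu0 : 0 ≤ |s - t| := abs_nonneg _
  have hst : s + t ≤ 2 * s + |s - t| := by
    rcases le_total s t with h | h
    · rw [abs_of_nonpos (by linarith)]; linarith
    · rw [abs_of_nonneg (by linarith)]; linarith
  -- `k|s−t|(s+t)PX ≤ 2s·(k|s−t|P)·X + k|s−t|²·P·X`
  have h1 : k * (|s - t| * (s + t)) * P * X ≤ 2 * (s * X) * (k * |s - t| * P) + k * |s - t| ^ 2 * P * X := by
    have := mul_le_mul_of_nonneg_left hst (by positivity : 0 ≤ k * |s - t| * P * X)
    nlinarith [this]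
  -- Young: `2(sX)(k|s−t|P) ≤ ½ s²X² + 2k²(s−t)²P²`
  have h2 : 2 * (s * X) * (k * |s - t| * P) ≤ 1 / 2 * s ^ 2 * X ^ 2 + 2 * (k ^ 2 * (s - t) ^ 2 * P ^ 2) := by
    have key : 1 / 2 * s ^ 2 * X ^ 2 + 2 * (k ^ 2 * (s - t) ^ 2 * P ^ 2) - 2 * (s * X) * (k * |s - t| * P)
        = 1 / 2 * (s * X - 2 * (k * |s - t| * P)) ^ 2 := by
      rw [← sq_abs (s - t)]; ring
    nlinarith [key, sq_nonneg (s * X - 2 * (k * |s - t| * P))]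
  -- `k|s−t|²PX ≤ k²(s−t)²·P(P+Q) ≤ k²(s−t)²(3∕2 P² + ½ Q²)`
  have h3 : k * |s - t| ^ 2 * P * X ≤ k ^ 2 * (s - t) ^ 2 * (3 / 2 * P ^ 2 + 1 / 2 * Q ^ 2) := by
    rw [sq_abs]
    have hA : 0 ≤ k * (s - t) ^ 2 * P := by positivity
    calc k * (s - t) ^ 2 * P * X ≤ k * (s - t) ^ 2 * P * (k * (P + Q)) := mul_le_mul_of_nonneg_left hXk hA
      _ = k ^ 2 * (s - t) ^ 2 * (P ^ 2 + P * Q) := by ring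
      _ ≤ k ^ 2 * (s - t) ^ 2 * (3 / 2 * P ^ 2 + 1 / 2 * Q ^ 2) :=
          mul_le_mul_of_nonneg_left (by nlinarith [sq_nonneg (P - Q)]) (by positivity)
  nlinarith [h1, h2, h3]

/-- **the pointwise Caccioppoli inequality**: with `s = η(x + e_ν)`, `t = η x` (`η ≥ 0`),
`½·s²‖∂_νz(x)‖² − ‖c‖²(s − t)²(7∕2‖z x‖² + ½‖z(x+e_ν)‖²) ≤ Re(conj(∂_ν(η²z)(x))·∂_νz(x))`. [folklore] -/
theorem pointwise (c : ℂ) (ν : Fin d) {η : Tor N → ℝ} (h0 : ∀ x, 0 ≤ η x) (z : Tor N → ℂ) (x : Tor N) :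
    1 / 2 * η (x + unitVec N ν) ^ 2 * ‖(sdiff N c ν *ᵥ z) x‖ ^ 2
        - ‖c‖ ^ 2 * (η (x + unitVec N ν) - η x) ^ 2 * (7 / 2 * ‖z x‖ ^ 2 + 1 / 2 * ‖z (x + unitVec N ν)‖ ^ 2)
      ≤ (conj ((sdiff N c ν *ᵥ cut N (fun y => η y ^ 2) z) x) * (sdiff N c ν *ᵥ z) x).re := by
  set s := η (x + unitVec N ν) with hs
  set t := η x with ht
  set p := z x with hp
  set q := z (x + unitVec N ν) with hq
  set a : ℂ := (sdiff N c ν *ᵥ z) x with ha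
  have ha' : a = c * (q - p) := by rw [ha, sdiff_mulVec]
  -- `∂_ν(η²z)(x) = s²·a + c(s² − t²)·p`
  have hA : (sdiff N c ν *ᵥ cut N (fun y => η y ^ 2) z) x = ((s ^ 2 : ℝ) : ℂ) * a + c * (((s ^ 2 - t ^ 2 : ℝ)) : ℂ) * p := by
    rw [sdiff_mulVec, ha']
    simp only [cut, hs, ht, hp, hq]
    push_cast
    ring
  rw [hA]
  -- `Re(conj(s²a + w)·a) = s²|a|² + Re(conj w · a) ≥ s²|a|² − |w||a|`
  have hre : (conj ((((s ^ 2 : ℝ) : ℂ)) * a + c * (((s ^ 2 - t ^ 2 : ℝ)) : ℂ) * p) * a).re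
      = s ^ 2 * ‖a‖ ^ 2 + (conj (c * (((s ^ 2 - t ^ 2 : ℝ)) : ℂ) * p) * a).re := by
    rw [map_add, add_mul, Complex.add_re, map_mul, Complex.conj_ofReal, mul_assoc, Complex.re_ofReal_mul,
      ← Complex.normSq_eq_conj_mul_self, Complex.normSq_eq_norm_sq, Complex.ofReal_re]
  have hlow : -(‖c‖ * |s ^ 2 - t ^ 2| * ‖p‖ * ‖a‖) ≤ (conj (c * (((s ^ 2 - t ^ 2 : ℝ)) : ℂ) * p) * a).re := by
    have h := Complex.abs_re_le_norm (conj (c * (((s ^ 2 - t ^ 2 : ℝ)) : ℂ) * p) * a)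
    rw [norm_mul, Complex.norm_conj, norm_mul, norm_mul, Complex.norm_real, Real.norm_eq_abs] at h
    have := neg_abs_le (conj (c * (((s ^ 2 - t ^ 2 : ℝ)) : ℂ) * p) * a).re
    linarith
  have hX : ‖a‖ ≤ ‖c‖ * (‖p‖ + ‖q‖) := by
    rw [ha', norm_mul]; exact mul_le_mul_of_nonneg_left ((norm_sub_le q p).trans (by linarith)) (norm_nonneg c)
  have hcore := core_ineq (h0 (x + unitVec N ν)) (h0 x) (norm_nonneg a) (norm_nonneg p) (norm_nonneg c) hX
  rw [hre]
  linarith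

/-! ## §2 The Caccioppoli inequality -/

/-- **DISCRETE CACCIOPPOLI**: for every field `z` and every real cutoff `η ≥ 0`,
`½·Σ_ν Σ_x η(x+e_ν)²‖∂_νz(x)‖² ≤ Re⟨η²z, Δz⟩ + ‖c‖²·Σ_ν Σ_x (η(x+e_ν) − η(x))²·(7∕2‖z x‖² + ½‖z(x+e_ν)‖²)`. [folklore] -/
theorem caccioppoli (c : ℂ) {η : Tor N → ℝ} (h0 : ∀ x, 0 ≤ η x) (z : Tor N → ℂ) :
    1 / 2 * ∑ ν : Fin d, ∑ x : Tor N, η (x + unitVec N ν) ^ 2 * ‖(sdiff N c ν *ᵥ z) x‖ ^ 2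
      ≤ (star (cut N (fun y => η y ^ 2) z) ⬝ᵥ (LapS N c *ᵥ z)).re
        + ‖c‖ ^ 2 * ∑ ν : Fin d, ∑ x : Tor N,
            (η (x + unitVec N ν) - η x) ^ 2 * (7 / 2 * ‖z x‖ ^ 2 + 1 / 2 * ‖z (x + unitVec N ν)‖ ^ 2) := by
  rw [star_dotProduct_LapS, Complex.re_sum, Finset.mul_sum, Finset.mul_sum, ← Finset.sum_add_distrib]
  refine Finset.sum_le_sum fun ν _ => ?_
  rw [star_dotProduct_eq_sum, Complex.re_sum, Finset.mul_sum, Finset.mul_sum, ← Finset.sum_add_distrib]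
  refine Finset.sum_le_sum fun x _ => ?_
  have h := pointwise N c ν h0 z x
  linarith

/-- **Caccioppoli for a field supported in a region**: the pairing only sees the COMPRESSED Laplacian `1_ΩΔz` (for a region solution:
the datum), since `η²z` vanishes off `Ω`. [folklore] -/
theorem caccioppoli_region {Ω : Tor N → Prop} [DecidablePred Ω] (c : ℂ) {η : Tor N → ℝ} (h0 : ∀ x, 0 ≤ η x) {z : Tor N → ℂ}
    (hz : ∀ x, ¬ Ω x → z x = 0) :
    1 / 2 * ∑ ν : Fin d, ∑ x : Tor N, η (x + unitVec N ν) ^ 2 * ‖(sdiff N c ν *ᵥ z) x‖ ^ 2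
      ≤ (star (cut N (fun y => η y ^ 2) z) ⬝ᵥ restrictTo Ω (LapS N c *ᵥ z)).re
        + ‖c‖ ^ 2 * ∑ ν : Fin d, ∑ x : Tor N,
            (η (x + unitVec N ν) - η x) ^ 2 * (7 / 2 * ‖z x‖ ^ 2 + 1 / 2 * ‖z (x + unitVec N ν)‖ ^ 2) := by
  have heq : star (cut N (fun y => η y ^ 2) z) ⬝ᵥ restrictTo Ω (LapS N c *ᵥ z) = star (cut N (fun y => η y ^ 2) z) ⬝ᵥ (LapS N c *ᵥ z) := by
    rw [star_dotProduct_eq_sum, star_dotProduct_eq_sum]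
    refine Finset.sum_congr rfl fun x _ => ?_
    by_cases hx : Ω x
    · simp [restrictTo, hx]
    · simp [restrictTo, hx, cut, hz x hx]
  rw [heq]
  exact caccioppoli N c h0 z

end Summit.QuantumFields.BalabanUV.T4Continuum.DirichletCaccioppoli

end
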